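import Summits.QuantumFields.BalabanUV.Beta.GAN24.Push3LegTelescope
import Summits.QuantumFields.BalabanUV.Beta.GAN24.Push3GaugeSlotCells
import Summits.QuantumFields.BalabanUV.Beta.GAN24.DressedLegEnvelope

/-!
# `BalabanUV.Beta.GAN24.ContactKernelCells` — binder row G-an2-4 / (CONV-C), the row owner's CONTACT-TERM ROUTE (`HOME/b2b-balaban-gan24-p1/gen17/CT-ROUTE-v1.md`
# §3, `gen18/CT3-MECHANISM.md` v1.1 §(c) / §3 «CT-3c `ContactAssembly`»), KERNEL HALF OF CT-3c: THE CONTACT TERM OF THE CUBIC WILSON PUSH — dressed composite legs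
# versus undressed one-shot legs — IS, ENTRY BY ENTRY, THE SUM OF THREE OF leaf-02's ONE-GAUGE CELLS WITH EXPLICIT LEGS AND EXPLICIT GAUGE FUNCTIONS.

NOT IN PRINT; OUR BOOKKEEPING (G-an2-4 formalisation swarm, leaf prover `b2b-balaban-gan24-formalise-leaf-01`, gen 58; «MINE» on CT-3c's `push₃`-level plumbing,
journal `CLAIMS.log` l.31499 ∕ l.31626; names PROVISIONAL — the owner may rename / re-cut).  HONEST FRAMING (cell contract, verbatim): «discharging `BetaPertH`
makes Bałaban's UV stability UNCONDITIONAL — a real constructive-QFT result; it is NOT the continuum limit and NOT the Clay problem.»  HONEST DEPENDENCY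
(verbatim): «continuum YM on T⁴ ⇐ BetaPertH ∧ nine spine estimates (0/9 proved); BetaPertH ⇐ (D1) ∧ (D4) ∧ CAP+tail; G-an2-4 gates asym, D1 and NE2/3/4.»

WHAT.
* §1 (generic `d`) **THE DIFFERENCE FAMILY IS A PURE GAUGE, KERNEL FORM**: leaf-01 g57's display `T^E b = T^B b + dz λ_b` (`DressedLegUnits.legAct_legChain_eq_add_dz`)
  read at the point datum `delta1 μ z` (`DressedLegEnvelope.legAct_delta1`):
  `legChain (respStepBmSeq ρ Lc) m k μ z κ u = respStep (Lc^m) (Lc^(m+k+1)) μ z κ u + dz (λ μ z) κ u`,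
  `λ μ z := Psi ρ Lc m k (delta1 μ z) − bmGaugeAt ρ (respStep (Lc^m) (Lc^(m+k+1)) μ z) Lc` (`legChain_respStepBmSeq_apply_eq_add_dz`, `legChain_respStepBmSeq_sub_respStep`).
* §2 (generic `d`, summable class) **CONTACT = THREE CELLS**: for any two readings `(lᴱ, rᴱ, wᴱ)`, `(lᴮ, rᴮ, wᴮ)` of the three legs differing slot by slot by pure gauges
  `dz λ_L`, `dz λ_R`, `dz λ_W`, the field entries of `push₃ lᴱ rᴱ wᴱ (wilsonA d) − push₃ lᴮ rᴮ wᴮ (wilsonA d)` are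
  `[cell_eq'-LHS (T₃ = rᴱ β z′, T₁ = wᴱ κ′ u′, ψ = λ_L α x′)] − [cell_eq'-LHS (T₃ = lᴮ α x′, T₁ = wᴱ κ′ u′, ψ = λ_R β z′)] + [cellIdx_eq'-LHS (TR = rᴮ β z′, TL = lᴮ α x′, ψ = λ_W κ′ u′)]`
  (`contact_ff_eq_cells`: `Push3LegTelescope.push₃_telescope` + `Push3GaugeSlotCells.push₃_gaugeLeft_ff ∕ _gaugeRight_ff ∕ _gaugeTable_ff`).
* §3 (`d = 3`, `2 ≤ Lc`, in-block root; NO further hypothesis) **THE INSTANCE OF THE ROUTE**: all three dressed legs = `legChain (respStepBmSeq ρ Lc) m k`, all three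
  undressed legs = `respStep (Lc^m) (Lc^(m+k+1))`, the three gauge functions = §1's `λ` — `contact_legChain_ff_eq_cells`; the summable class is discharged by leaf-01 g57's
  `DressedLegEnvelope.exists_legChain_envelope` and leaf-12's (N1) `RespStepDecay.exists_respStep_decay_and_grad` (envelopes ⇒ bounded + summable,
  `Push3LegTelescope.abs_le_of_env' ∕ summable_of_env'`).
What is LEFT of CT-3c after this module is analysis only: leaf-02's `ContactOneGaugeCellTable.abs_cell_le' ∕ abs_cellIdx_le'` on each cell (envelopes: `Psi_delta1_envelope`
+ `bmGaugeAt_respStep_envelope` for `λ`, (N1) ∕ `exists_legChain_envelope` for the partners, d4-p3's I2 for `d*d` of the undressed partner = of the dressed one by leaf-03's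
§10 p271047), with the owner's `StaircasePairing.abs_pairing_le_sum` for the dressed partners' `dzΨ′` parts, and the units.
[folklore] throughout: bookkeeping over tree theorems BY NAME; 0 `def`, 0 cited facts, 0 `def … : Prop`, 0 sorry.  NO estimate; discharges NOTHING of (hS, hSall) on (E);
0 wall binders; NEVER «G-an2-4 closed»; NOT D1, NOT BetaPertH, NOT continuum, NOT Clay.
-/

noncomputable section

open Finset
open scoped BigOperators
open Literature.MathematicalPhysics.QuantumFieldTheory
open Literature.MathematicalPhysics.QuantumFieldTheory.LatticeForm (quo)
open Literature.MathematicalPhysics.QuantumFieldTheory.Balaban1983to89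
open Literature.MathematicalPhysics.QuantumFieldTheory.Balaban1983to89.Beta
open B4ContourShift (supNorm)
open OneStepResolventKernel (Fib LocStencil)
open StepJetData (wilsonA locStencil_wilsonA)
open AffineAveraging (Form1 Site box toSite dz curv curvAdj)
open B6BondElimination (unitVec)
open KKTFluctuationKernel (delta1)
open BalabanCompositeJets (respStep)
open Summit.QuantumFields.BalabanUV.Beta.AxialProjectorBlockMean (bmGaugeAt)
open Summit.QuantumFields.BalabanUV.Beta.GAN24.Push4Iter (LegFam legChain)
open Summit.QuantumFields.BalabanUV.Beta.GAN24.RespStepBmDecompLegs (legAct)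
open Summit.QuantumFields.BalabanUV.Beta.GAN24.RespStepBmDecompExact (respStepBmSeq)
open Summit.QuantumFields.BalabanUV.Beta.GAN24.RespStepBmDecompPsi (Psi)
open Summit.QuantumFields.BalabanUV.Beta.GAN24.RespStepDecay (exists_respStep_decay_and_grad)
open Summit.QuantumFields.BalabanUV.Beta.GAN24.UndressedResponseUnits (inv_cast_pow_pow)
open Summit.QuantumFields.BalabanUV.Beta.GAN24.DressedLegUnits (legAct_legChain_eq_add_dz)
open Summit.QuantumFields.BalabanUV.Beta.GAN24.DressedLegEnvelope (summable_single_and_le single_eq_delta1 legAct_delta1 exists_legChain_envelope)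
open Summit.QuantumFields.BalabanUV.Beta.GAN24.Push3 (push₃)
open Summit.QuantumFields.BalabanUV.Beta.GAN24.Push3LegTelescope (push₃_telescope abs_le_of_env' summable_of_env')
open Summit.QuantumFields.BalabanUV.Beta.GAN24.Push3GaugeSlotCells (push₃_gaugeLeft_ff push₃_gaugeRight_ff push₃_gaugeTable_ff)

namespace Summit.QuantumFields.BalabanUV.Beta.GAN24.ContactKernelCells

variable {d : ℕ}

/-! ## §1 The difference of the dressed and the undressed composite leg families is a pure gauge — kernel form (generic `d`) -/

section Gauge

variable {Lc : ℕ} [NeZero Lc]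

/-- [folklore] The point datum `delta1 μ z` is componentwise summable. -/
theorem summable_delta1 (μ : Fin (d + 1)) (z : Site (d + 1)) (μ' : Fin (d + 1)) : Summable (delta1 (d := d) μ z μ') := by
  have h := (summable_single_and_le (d := d) μ z).1 μ'
  rw [single_eq_delta1] at h
  exact h

/-- [folklore] A leg family acting on the point datum `delta1 μ z` is its own `(μ, z)`-member, as a 1-form (`DressedLegEnvelope.legAct_delta1`, `funext`). -/
theorem legAct_delta1_eq (r : LegFam d) (μ : Fin (d + 1)) (z : Site (d + 1)) : legAct r (delta1 μ z) = r μ z := by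
  funext κ u; exact legAct_delta1 r μ z κ u

/-- NOT IN PRINT; OUR BOOKKEEPING.  **THE DRESSED COMPOSITE LEG, KERNEL ENTRY BY KERNEL ENTRY, IS THE UNDRESSED ONE-SHOT RESPONSE PLUS A PURE GAUGE**
(generic `d`, in-block root `ρ = toSite rr`; leaf-01 g57's `legAct_legChain_eq_add_dz` at the point datum): for every source bond `(μ, z)` and output bond `(κ, u)`,
`legChain (respStepBmSeq ρ Lc) m k μ z κ u = respStep (Lc^m) (Lc^(m+k+1)) μ z κ u + dz (λ μ z) κ u` with the GAUGE FUNCTION OF THE BOND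
`λ μ z := Psi ρ Lc m k (delta1 μ z) − bmGaugeAt ρ (respStep (Lc^m) (Lc^(m+k+1)) μ z) Lc`. -/
theorem legChain_respStepBmSeq_apply_eq_add_dz {rr : Fin (d + 1) → ℕ} (hrr : rr ∈ box (d + 1) Lc) (m k : ℕ) (μ : Fin (d + 1))
    (z : Site (d + 1)) (κ : Fin (d + 1)) (u : Site (d + 1)) :
    legChain (respStepBmSeq (d := d) (toSite rr) Lc) m k μ z κ u
      = respStep (d := d) (Lc ^ m) (Lc ^ (m + k + 1)) μ z κ u
        + dz (Psi (toSite rr) Lc m k (delta1 μ z)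
            - bmGaugeAt (toSite rr) (respStep (d := d) (Lc ^ m) (Lc ^ (m + k + 1)) μ z) Lc) κ u := by
  rw [← legAct_delta1 (legChain (respStepBmSeq (d := d) (toSite rr) Lc) m k) μ z κ u,
    legAct_legChain_eq_add_dz hrr m k (summable_delta1 μ z), Pi.add_apply, Pi.add_apply, legAct_delta1_eq]

/-- NOT IN PRINT; OUR BOOKKEEPING.  **THE DIFFERENCE FAMILY IS THE PURE-GAUGE FAMILY OF `Push3GaugeSlotCells`**:
`legChain (respStepBmSeq ρ Lc) m k − respStep (Lc^m) (Lc^(m+k+1)) = (μ, z, κ, u) ↦ dz (λ μ z) κ u`, `λ` as above. -/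
theorem legChain_respStepBmSeq_sub_respStep {rr : Fin (d + 1) → ℕ} (hrr : rr ∈ box (d + 1) Lc) (m k : ℕ) :
    legChain (respStepBmSeq (d := d) (toSite rr) Lc) m k - respStep (d := d) (Lc ^ m) (Lc ^ (m + k + 1))
      = fun μ z κ u => dz (Psi (toSite rr) Lc m k (delta1 μ z)
          - bmGaugeAt (toSite rr) (respStep (d := d) (Lc ^ m) (Lc ^ (m + k + 1)) μ z) Lc) κ u := by
  funext μ z κ u
  rw [Pi.sub_apply, Pi.sub_apply, Pi.sub_apply, Pi.sub_apply, legChain_respStepBmSeq_apply_eq_add_dz hrr, add_sub_cancel_left]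

end Gauge

/-! ## §2 CONTACT = THREE ONE-GAUGE CELLS (generic `d`, summable class) -/

section Cells

variable {lE lB rE rB wE wB : LegFam d} {lamL lamR lamW : Fin (d + 1) → Site (d + 1) → Site (d + 1) → ℝ} {ClE ClB CrE CrB CwE CwB : ℝ}

/-- NOT IN PRINT; OUR BOOKKEEPING.  **THE CONTACT TERM OF THE CUBIC WILSON PUSH IS THE SUM OF THREE ONE-GAUGE CELLS** (generic `d`): two readings
`(lᴱ, rᴱ, wᴱ)` and `(lᴮ, rᴮ, wᴮ)` of the three legs on the summable class (every leg BOUNDED with SUMMABLE fine slices), differing slot by slot by pure gauges —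
`lᴱ − lᴮ = dz λ_L`, `rᴱ − rᴮ = dz λ_R`, `wᴱ − wᴮ = dz λ_W` (one gauge function per coarse bond) — give, at every coarse triple `(κ′,u′), (α,x′), (β,z′)`,
`push₃ lᴱ rᴱ wᴱ W − push₃ lᴮ rᴮ wᴮ W` `(x′, z′, inl α, inl β)`
`= Σ'_z Σ_b rᴱ β z′ b z · Σ'_u Σ_κ wᴱ κ′ u′ κ u · (½(λ_L αx′ (u+e_κ) − ½(λ_L αx′ z + λ_L αx′ (z+e_b)))·(d*dδ_{(κ,u)})_b z)`        (LEFT slot; partners `rᴱ, wᴱ`)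
`− Σ'_x Σ_a lᴮ α x′ a x · Σ'_u Σ_κ wᴱ κ′ u′ κ u · (½(λ_R βz′ (u+e_κ) − ½(λ_R βz′ x + λ_R βz′ (x+e_a)))·(d*dδ_{(κ,u)})_a x)`        (RIGHT slot; partners `lᴮ, wᴱ`)
`+ Σ'_z Σ_b rᴮ β z′ b z · Σ'_x Σ_a lᴮ α x′ a x · (½(λ_W κ′u′ z − λ_W κ′u′ x)·(d*dδ_{(b,z)})_a x)`                                    (TABLE slot; partners `lᴮ, rᴮ`)
— the three left-hand sides of leaf-02's `ContactOneGaugeCellTable.cell_eq'` (twice) and `cellIdx_eq'`, `W = wilsonA d`. -/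
theorem contact_ff_eq_cells
    (hlE : ∀ α x' κ x, |lE α x' κ x| ≤ ClE) (hlEs : ∀ α x' κ, Summable fun x => lE α x' κ x)
    (hlB : ∀ α x' κ x, |lB α x' κ x| ≤ ClB) (hlBs : ∀ α x' κ, Summable fun x => lB α x' κ x)
    (hrE : ∀ β z' κ z, |rE β z' κ z| ≤ CrE) (hrEs : ∀ β z' κ, Summable fun z => rE β z' κ z)
    (hrB : ∀ β z' κ z, |rB β z' κ z| ≤ CrB) (hrBs : ∀ β z' κ, Summable fun z => rB β z' κ z)
    (hwE : ∀ κ' u' κ u, |wE κ' u' κ u| ≤ CwE) (hwB : ∀ κ' u' κ u, |wB κ' u' κ u| ≤ CwB)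
    (hL : lE - lB = fun μ y κ u => dz (lamL μ y) κ u) (hR : rE - rB = fun μ y κ u => dz (lamR μ y) κ u)
    (hW : wE - wB = fun μ y κ u => dz (lamW μ y) κ u)
    (κ' : Fin (d + 1)) (u' x' z' : Site (d + 1)) (α β : Fin (d + 1)) :
    push₃ lE rE wE (wilsonA d) κ' u' x' z' (Sum.inl α) (Sum.inl β) - push₃ lB rB wB (wilsonA d) κ' u' x' z' (Sum.inl α) (Sum.inl β)
      = (∑' z, ∑ b, rE β z' b z * ∑' u, ∑ κ, wE κ' u' κ u *
            ((1 / 2 : ℝ) * (lamL α x' (u + unitVec κ) - (lamL α x' z + lamL α x' (z + unitVec b)) / 2) * curvAdj (curv (delta1 κ u)) b z))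
        - (∑' x, ∑ a, lB α x' a x * ∑' u, ∑ κ, wE κ' u' κ u *
            ((1 / 2 : ℝ) * (lamR β z' (u + unitVec κ) - (lamR β z' x + lamR β z' (x + unitVec a)) / 2) * curvAdj (curv (delta1 κ u)) a x))
        + (∑' z, ∑ b, rB β z' b z * ∑' x, ∑ a, lB α x' a x *
            ((1 / 2 : ℝ) * (lamW κ' u' z - lamW κ' u' x) * curvAdj (curv (delta1 b z)) a x)) := by
  -- the cubic Wilson family is a local stencil family at rate 1
  have hS := locStencil_wilsonA (d := d) zero_le_one
  -- the gauge increments of the right slot are bounded (difference of two bounded families)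
  have hgR : ∀ μ y κ u, |dz (lamR μ y) κ u| ≤ CrE + CrB := by
    intro μ y κ u
    have e : dz (lamR μ y) κ u = (rE - rB) μ y κ u := by rw [hR]
    rw [e, Pi.sub_apply, Pi.sub_apply, Pi.sub_apply, Pi.sub_apply]
    exact (abs_sub _ _).trans (add_le_add (hrE μ y κ u) (hrB μ y κ u))
  have htel := push₃_telescope (S := wilsonA d) hlE hlEs hlB hlBs hrEs hrBs hwE hwB hS one_pos κ' u'
  have h := congrFun (congrFun (congrFun (congrFun htel x') z') (Sum.inl α)) (Sum.inl β)
  simp only [Pi.sub_apply, Pi.add_apply] at h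
  rw [h, hL, hR, hW, push₃_gaugeLeft_ff, push₃_gaugeRight_ff hlBs hgR hwE, push₃_gaugeTable_ff]
  ring

end Cells

/-! ## §3 `d = 3`: the route's instance, unconditionally -/

section Four

variable {Lc : ℕ} [NeZero Lc]

/-- NOT IN PRINT; OUR BOOKKEEPING.  **CT-3c, KERNEL HALF — THE CONTACT TERM OF THE DRESSED CUBIC WILSON PUSH IS THREE EXPLICIT ONE-GAUGE CELLS**
(`d = 3`, `2 ≤ Lc`, in-block root `ρ = toSite rr`; every `m k`; NO other hypothesis): with the dressed composite legs `T := legChain (respStepBmSeq ρ Lc) m k`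
in all three slots, the undressed one-shot legs `B := respStep (Lc^m) (Lc^(m+k+1))` in all three slots, and the bond gauge functions
`λ μ z := Psi ρ Lc m k (delta1 μ z) − bmGaugeAt ρ (B μ z) Lc` (§1), every field entry of `push₃ T T T (wilsonA 3) κ′ u′ − push₃ B B B (wilsonA 3) κ′ u′` equals
`[LEFT cell: T₃ = T β z′, T₁ = T κ′ u′, ψ = λ α x′] − [RIGHT cell: T₃ = B α x′, T₁ = T κ′ u′, ψ = λ β z′] + [TABLE cell: TR = B β z′, TL = B α x′, ψ = λ κ′ u′]`
in leaf-02's `cell_eq'` ∕ `cellIdx_eq'` nesting.  The summable class is discharged by leaf-01 g57's `exists_legChain_envelope` (dressed) and leaf-12's (N1)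
`exists_respStep_decay_and_grad` (undressed).  What remains of CT-3c is the analysis of the three cells (leaf-02's `abs_cell_le'` ∕ `abs_cellIdx_le'`, the
owner's `StaircasePairing` for the dressed partners' gauge parts, d4-p3's I2) and the units. -/
theorem contact_legChain_ff_eq_cells (hLc : 2 ≤ Lc) {rr : Fin (3 + 1) → ℕ} (hrr : rr ∈ box (3 + 1) Lc) (m k : ℕ)
    (κ' : Fin (3 + 1)) (u' x' z' : Site (3 + 1)) (α β : Fin (3 + 1)) :
    push₃ (legChain (respStepBmSeq (d := 3) (toSite rr) Lc) m k) (legChain (respStepBmSeq (d := 3) (toSite rr) Lc) m k)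
        (legChain (respStepBmSeq (d := 3) (toSite rr) Lc) m k) (wilsonA 3) κ' u' x' z' (Sum.inl α) (Sum.inl β)
      - push₃ (respStep (d := 3) (Lc ^ m) (Lc ^ (m + k + 1))) (respStep (d := 3) (Lc ^ m) (Lc ^ (m + k + 1)))
        (respStep (d := 3) (Lc ^ m) (Lc ^ (m + k + 1))) (wilsonA 3) κ' u' x' z' (Sum.inl α) (Sum.inl β)
      = (∑' z, ∑ b, legChain (respStepBmSeq (d := 3) (toSite rr) Lc) m k β z' b z *
            ∑' u, ∑ κ, legChain (respStepBmSeq (d := 3) (toSite rr) Lc) m k κ' u' κ u *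
              ((1 / 2 : ℝ) *
                ((Psi (toSite rr) Lc m k (delta1 α x') - bmGaugeAt (toSite rr) (respStep (d := 3) (Lc ^ m) (Lc ^ (m + k + 1)) α x') Lc) (u + unitVec κ)
                  - ((Psi (toSite rr) Lc m k (delta1 α x') - bmGaugeAt (toSite rr) (respStep (d := 3) (Lc ^ m) (Lc ^ (m + k + 1)) α x') Lc) z
                    + (Psi (toSite rr) Lc m k (delta1 α x') - bmGaugeAt (toSite rr) (respStep (d := 3) (Lc ^ m) (Lc ^ (m + k + 1)) α x') Lc)
                      (z + unitVec b)) / 2) * curvAdj (curv (delta1 κ u)) b z))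
        - (∑' x, ∑ a, respStep (d := 3) (Lc ^ m) (Lc ^ (m + k + 1)) α x' a x *
            ∑' u, ∑ κ, legChain (respStepBmSeq (d := 3) (toSite rr) Lc) m k κ' u' κ u *
              ((1 / 2 : ℝ) *
                ((Psi (toSite rr) Lc m k (delta1 β z') - bmGaugeAt (toSite rr) (respStep (d := 3) (Lc ^ m) (Lc ^ (m + k + 1)) β z') Lc) (u + unitVec κ)
                  - ((Psi (toSite rr) Lc m k (delta1 β z') - bmGaugeAt (toSite rr) (respStep (d := 3) (Lc ^ m) (Lc ^ (m + k + 1)) β z') Lc) x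
                    + (Psi (toSite rr) Lc m k (delta1 β z') - bmGaugeAt (toSite rr) (respStep (d := 3) (Lc ^ m) (Lc ^ (m + k + 1)) β z') Lc)
                      (x + unitVec a)) / 2) * curvAdj (curv (delta1 κ u)) a x))
        + (∑' z, ∑ b, respStep (d := 3) (Lc ^ m) (Lc ^ (m + k + 1)) β z' b z *
            ∑' x, ∑ a, respStep (d := 3) (Lc ^ m) (Lc ^ (m + k + 1)) α x' a x *
              ((1 / 2 : ℝ) *
                ((Psi (toSite rr) Lc m k (delta1 κ' u') - bmGaugeAt (toSite rr) (respStep (d := 3) (Lc ^ m) (Lc ^ (m + k + 1)) κ' u') Lc) z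
                  - (Psi (toSite rr) Lc m k (delta1 κ' u') - bmGaugeAt (toSite rr) (respStep (d := 3) (Lc ^ m) (Lc ^ (m + k + 1)) κ' u') Lc) x) *
                curvAdj (curv (delta1 b z)) a x)) := by
  -- the summable class: dressed legs by leaf-01 g57's envelope, undressed legs by leaf-12's (N1)
  have hL1 : 1 ≤ Lc ^ (k + 1) := Nat.one_le_pow _ _ (Nat.pos_of_ne_zero (NeZero.ne Lc))
  obtain ⟨κE, KE, hκE, -, hE⟩ := exists_legChain_envelope (Lc := Lc) hLc
  obtain ⟨κB, C, -, hκB, -, -, hN1, -⟩ := exists_respStep_decay_and_grad (Lc := Lc)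
  have hEnv : ∀ μ y κ u, |legChain (respStepBmSeq (d := 3) (toSite rr) Lc) m k μ y κ u|
      ≤ KE * ((Lc : ℝ) ^ (4 * (k + 1)))⁻¹ * Real.exp (-(κE * supNorm (quo (Lc ^ (k + 1)) u - y))) := fun μ y κ u => hE rr hrr m k μ y κ u
  have hBnv : ∀ μ y κ u, |respStep (d := 3) (Lc ^ m) (Lc ^ (m + k + 1)) μ y κ u|
      ≤ C * ((Lc : ℝ) ^ ((3 + 2) * (k + 1)))⁻¹ * Real.exp (-(κB * supNorm (quo (Lc ^ (k + 1)) u - y))) := by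
    intro μ y κ u
    have h := hN1 m k μ y κ u
    rwa [inv_cast_pow_pow] at h
  exact contact_ff_eq_cells (abs_le_of_env' hκE.le hEnv) (summable_of_env' hL1 hκE hEnv) (abs_le_of_env' hκB.le hBnv)
    (summable_of_env' hL1 hκB hBnv) (abs_le_of_env' hκE.le hEnv) (summable_of_env' hL1 hκE hEnv) (abs_le_of_env' hκB.le hBnv)
    (summable_of_env' hL1 hκB hBnv) (abs_le_of_env' hκE.le hEnv) (abs_le_of_env' hκB.le hBnv)
    (legChain_respStepBmSeq_sub_respStep hrr m k) (legChain_respStepBmSeq_sub_respStep hrr m k)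
    (legChain_respStepBmSeq_sub_respStep hrr m k) κ' u' x' z' α β

end Four

end Summit.QuantumFields.BalabanUV.Beta.GAN24.ContactKernelCells

end
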